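import Summits.AtomisticToContinuum.BoseEinsteinCondensation.Theorems.BECTangentRigidityRigidMomentumBoundSmearStepInt
import HarnessLib

/-!
# Crux `RigidMomentumBound` (stmt-AtomisticToContinuum-13034), line `registered`:
# the registered stub `stub_smearStep` (rigid smearing step)

Supports (does not close) stmt-AtomisticToContinuum-13034; proves the registered stub `stub_smearStep`
of the line `registered` (lead c3) from parts 1–5 (`…SmearStepAux/Core/F/Deriv/Int.lean`).

**Statement.** For a measurable pair potential `v`, an admissible `Φ` in the box of side `L₀`, a
direction `a`, `τ > 0`, `s > 0`, given the calculus facts (H2) about the smeared square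
`F(X) = ∫₀^{2τ}|Φ(X - t𝟙ₐ)|²w(t)dt` and the weight facts (H3) about `w(t) = τ⁻¹sin²(πt/(2τ))`, there is
an admissible `Θ` in the box of side `L₀ + 2τ` with `⟨Θ,H_relΘ⟩ ≤ ⟨Φ,H_relΦ⟩ + s`,
`∫|∑ⱼ∂_{j,b}Θ|² ≤ ∫|∑ⱼ∂_{j,b}Φ|² + s` for all `b`, and `∫|∑ⱼ∂_{j,a}Θ|² ≤ π²/(4τ²) + s`.

**Proof.** `Θ = c(√(η² + F) - η)` with `η > 0` small and `c` the normalisation: by parts 4–5 the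
unnormalised function has relative energy `≤ ⟨Φ,H_relΦ⟩`, rigid derivatives `≤` those of `Φ`, smeared
rigid derivative `≤ π²/(4τ²)`, and norm `m ∈ [1 - 2η∫√F, 1]`; the normalisation `c² = m⁻¹` costs the
slack `s` once `η ≤ β/(2∫√F + 2)` with `β = min(½, s/(2T))`, `T` the sum of the (finite) quantities
involved (`inv_mul_le_add_of_le`). This is the convexity inequality for gradients
(Lieb–Loss, *Analysis*, Thm 7.8) applied to the family of rigid translates; folklore.
-/

noncomputable section

open MeasureTheory Filter Set
open scoped ENNReal NNReal Topology

namespace Summit.AtomisticToContinuum.BoseEinsteinCondensation.Theorems.RigidMomentumBound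

open Literature.MathematicalPhysics.QuantumManyBody.BoseGas
open SmearStep

/-- `ofReal β * Q ≤ ofReal s / 2` when `Q` is finite with `Q.toReal ≤ T` and `β T ≤ s/2`, `β ≥ 0`.
(Slack bookkeeping.) [folklore] -/
theorem ofReal_mul_le_half {β s T : ℝ} {Q : ℝ≥0∞} (hQ : Q ≠ ⊤) (hβ : 0 ≤ β) (hQT : Q.toReal ≤ T)
    (hβT : β * T ≤ s / 2) : ENNReal.ofReal β * Q ≤ ENNReal.ofReal s / 2 := by
  rw [← ENNReal.ofReal_toReal hQ, ← ENNReal.ofReal_mul hβ, ← ENNReal.ofReal_ofNat,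
    ← ENNReal.ofReal_div_of_pos two_pos]
  exact ENNReal.ofReal_le_ofReal ((mul_le_mul_of_nonneg_left hQT hβ).trans hβT)

/-- **`stub_smearStep`** (registered stub of the line `registered` for the crux `RigidMomentumBound`):
the rigid smearing step — see the module docstring. [folklore] -/
theorem stub_smearStep :
    ∀ {N : ℕ} {L₀ : ℝ} (v : ℝ → ℝ≥0∞), Measurable v → ∀ (Φ : TrialState N L₀) (a : Fin 3) (τ s : ℝ),
      0 < τ → 0 < s →
      (ContDiff ℝ 1 (fun X : Config N => ∫ t in (0 : ℝ)..(2 * τ),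
          ‖Φ.ψ (X - t • (fun _ : Fin N => EuclideanSpace.single a (1 : ℝ)))‖ ^ 2 *
            (τ⁻¹ * Real.sin (Real.pi * t / (2 * τ)) ^ 2))) ∧
      (∀ X Y : Config N,
        fderiv ℝ (fun X : Config N => ∫ t in (0 : ℝ)..(2 * τ),
            ‖Φ.ψ (X - t • (fun _ : Fin N => EuclideanSpace.single a (1 : ℝ)))‖ ^ 2 *
              (τ⁻¹ * Real.sin (Real.pi * t / (2 * τ)) ^ 2)) X Y =
          ∫ t in (0 : ℝ)..(2 * τ),
            fderiv ℝ (fun Z : Config N => ‖Φ.ψ Z‖ ^ 2)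
                (X - t • (fun _ : Fin N => EuclideanSpace.single a (1 : ℝ))) Y *
              (τ⁻¹ * Real.sin (Real.pi * t / (2 * τ)) ^ 2)) ∧
      (∀ X : Config N,
        fderiv ℝ (fun X : Config N => ∫ t in (0 : ℝ)..(2 * τ),
            ‖Φ.ψ (X - t • (fun _ : Fin N => EuclideanSpace.single a (1 : ℝ)))‖ ^ 2 *
              (τ⁻¹ * Real.sin (Real.pi * t / (2 * τ)) ^ 2)) X
            (fun _ : Fin N => EuclideanSpace.single a (1 : ℝ)) =
          ∫ t in (0 : ℝ)..(2 * τ),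
            ‖Φ.ψ (X - t • (fun _ : Fin N => EuclideanSpace.single a (1 : ℝ)))‖ ^ 2 *
              (Real.pi / (2 * τ ^ 2) * Real.sin (Real.pi * t / τ))) →
      ((∫ t in (0 : ℝ)..(2 * τ), τ⁻¹ * Real.sin (Real.pi * t / (2 * τ)) ^ 2) = 1 ∧
      (∫ t in (0 : ℝ)..(2 * τ), Real.pi ^ 2 / τ ^ 3 * Real.cos (Real.pi * t / (2 * τ)) ^ 2) =
          Real.pi ^ 2 / τ ^ 2 ∧
      (∀ t : ℝ, (Real.pi / (2 * τ ^ 2) * Real.sin (Real.pi * t / τ)) ^ 2 =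
          (τ⁻¹ * Real.sin (Real.pi * t / (2 * τ)) ^ 2) *
            (Real.pi ^ 2 / τ ^ 3 * Real.cos (Real.pi * t / (2 * τ)) ^ 2)) ∧
      (∀ t : ℝ, HasDerivAt (fun t : ℝ => τ⁻¹ * Real.sin (Real.pi * t / (2 * τ)) ^ 2)
          (Real.pi / (2 * τ ^ 2) * Real.sin (Real.pi * t / τ)) t)) →
      ∃ Θ : TrialState N (L₀ + 2 * τ),
        relEnergy v Θ ≤ relEnergy v Φ + ENNReal.ofReal s ∧
        (∀ b : Fin 3,
          (∫⁻ X, (‖fderiv ℝ Θ.ψ X (fun _ : Fin N => EuclideanSpace.single b (1 : ℝ))‖₊ : ℝ≥0∞) ^ 2) ≤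
            (∫⁻ X, (‖fderiv ℝ Φ.ψ X (fun _ : Fin N => EuclideanSpace.single b (1 : ℝ))‖₊ : ℝ≥0∞) ^ 2) +
              ENNReal.ofReal s) ∧
        (∫⁻ X, (‖fderiv ℝ Θ.ψ X (fun _ : Fin N => EuclideanSpace.single a (1 : ℝ))‖₊ : ℝ≥0∞) ^ 2) ≤
          ENNReal.ofReal (Real.pi ^ 2 / (4 * τ ^ 2) + s) := by
  intro N L₀ v hv Φ a τ s hτ hs H2 H3
  obtain ⟨hFdiff₀, hFderiv₀, hFrigid₀⟩ := H2
  obtain ⟨hw1₀, hu1₀, hwu₀, -⟩ := H3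
  -- names for the weight, its companions and the smeared square
  set D : Config N := fun _ : Fin N => EuclideanSpace.single a (1 : ℝ) with hD
  set w : ℝ → ℝ := fun t => τ⁻¹ * Real.sin (Real.pi * t / (2 * τ)) ^ 2 with hw
  set u : ℝ → ℝ := fun t => Real.pi ^ 2 / τ ^ 3 * Real.cos (Real.pi * t / (2 * τ)) ^ 2 with hu
  set w' : ℝ → ℝ := fun t => Real.pi / (2 * τ ^ 2) * Real.sin (Real.pi * t / τ) with hw'
  set F : Config N → ℝ := fun X => ∫ t in (0 : ℝ)..(2 * τ), ‖Φ.ψ (X - t • D)‖ ^ 2 * w t with hF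
  have hFdiff : ContDiff ℝ 1 F := hFdiff₀
  have hFderiv : ∀ X Y : Config N, fderiv ℝ F X Y = ∫ t in (0 : ℝ)..(2 * τ),
      fderiv ℝ (fun Z : Config N => ‖Φ.ψ Z‖ ^ 2) (X - t • D) Y * w t := hFderiv₀
  have hFrigid : ∀ X : Config N, fderiv ℝ F X D = ∫ t in (0 : ℝ)..(2 * τ),
      ‖Φ.ψ (X - t • D)‖ ^ 2 * w' t := hFrigid₀
  have hw1 : ∫ t in (0 : ℝ)..(2 * τ), w t = 1 := hw1₀
  have hu1 : ∫ t in (0 : ℝ)..(2 * τ), u t = Real.pi ^ 2 / τ ^ 2 := hu1₀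
  have hwu : ∀ t, (w' t) ^ 2 = w t * u t := hwu₀
  have hw0 : ∀ t, 0 ≤ w t := w_nonneg hτ hw
  have hu0 : ∀ t, 0 ≤ u t := u_nonneg hτ hu
  have hwc : Continuous w := w_continuous hw
  have huc : Continuous u := u_continuous hu
  have habs : ∀ t, |w' t| = Real.sqrt (w t) * Real.sqrt (u t) := abs_w'_eq hw0 hwu
  -- the finite quantities entering the slack, and the regularisation parameter `η`
  set J : ℝ≥0∞ := ∫⁻ X, ENNReal.ofReal (Real.sqrt (F X)) with hJ
  have hJtop : J ≠ ⊤ := (lintegral_sqrt_F_lt_top Φ a hτ hw0 hwc hw1 hF).ne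
  set R : Fin 3 → ℝ≥0∞ := fun b =>
    ∫⁻ X, (‖fderiv ℝ Φ.ψ X (fun _ : Fin N => EuclideanSpace.single b (1 : ℝ))‖₊ : ℝ≥0∞) ^ 2 with hR
  set T : ℝ := (relEnergy v Φ).toReal + ∑ b : Fin 3, (R b).toReal + Real.pi ^ 2 / (4 * τ ^ 2) + 1 with hT
  have hRnn : 0 ≤ ∑ b : Fin 3, (R b).toReal := Finset.sum_nonneg fun b _ => ENNReal.toReal_nonneg
  have hTpos : 0 < T := by
    have h1 : (0 : ℝ) ≤ (relEnergy v Φ).toReal := ENNReal.toReal_nonneg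
    have h2 : (0 : ℝ) ≤ Real.pi ^ 2 / (4 * τ ^ 2) := by positivity
    linarith
  set β : ℝ := min 2⁻¹ (s / (2 * T)) with hβ
  have hβpos : 0 < β := lt_min (by norm_num) (by positivity)
  have hβhalf : β ≤ 2⁻¹ := min_le_left _ _
  have hβT : β * T ≤ s / 2 := by
    calc β * T ≤ s / (2 * T) * T := mul_le_mul_of_nonneg_right (min_le_right _ _) hTpos.le
      _ = s / 2 := by field_simp
  set η : ℝ := β / (2 * (J.toReal + 1)) with hη
  have hηpos : 0 < η := by positivity
  set b : ℝ≥0∞ := ENNReal.ofReal β with hb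
  have hbhalf : b ≤ 2⁻¹ := by
    rw [hb, ← ENNReal.ofReal_ofNat, ← ENNReal.ofReal_inv_of_pos two_pos]
    exact ENNReal.ofReal_le_ofReal hβhalf
  have hηJ : ENNReal.ofReal (2 * η) * J ≤ b := by
    rw [hb, ← ENNReal.ofReal_toReal hJtop, ← ENNReal.ofReal_mul (by positivity)]
    refine ENNReal.ofReal_le_ofReal ?_
    rw [hη]
    have hJ0 : 0 ≤ J.toReal := ENNReal.toReal_nonneg
    rw [show 2 * (β / (2 * (J.toReal + 1))) * J.toReal = β * (J.toReal / (J.toReal + 1)) by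
      field_simp]
    calc β * (J.toReal / (J.toReal + 1)) ≤ β * 1 := by
          refine mul_le_mul_of_nonneg_left ?_ hβpos.le
          rw [div_le_one (by positivity)]; linarith
      _ = β := mul_one β
  -- the regularised square root and its complexification
  set θ : Config N → ℝ := fun X => Real.sqrt (η ^ 2 + F X) - η with hθ
  have hθC1 : ContDiff ℝ 1 θ := contDiff_theta Φ a hτ hw0 hF hFdiff hηpos
  have hθdiff : Differentiable ℝ θ := hθC1.differentiable one_ne_zero
  set Θ₀ : Config N → ℂ := fun X => ((θ X : ℝ) : ℂ) with hΘ₀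
  have hΘ₀C1 : ContDiff ℝ 1 Θ₀ := Complex.ofRealCLM.contDiff.comp hθC1
  have hΘ₀diff : Differentiable ℝ Θ₀ := hΘ₀C1.differentiable one_ne_zero
  have hΘ₀sq : ∀ X, ((‖Θ₀ X‖₊ : ℝ≥0∞)) ^ 2 = ENNReal.ofReal ((θ X) ^ 2) := fun X => sq_nnnorm_ofReal _
  have hΘ₀fd : ∀ X Y, ((‖fderiv ℝ Θ₀ X Y‖₊ : ℝ≥0∞)) ^ 2 = ENNReal.ofReal ((fderiv ℝ θ X Y) ^ 2) :=
    fun X Y => sq_nnnorm_fderiv_ofReal_comp hθdiff X Y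
  -- the norm `m` of `Θ₀` and its two-sided control
  set m : ℝ≥0∞ := ∫⁻ X, ((‖Θ₀ X‖₊ : ℝ≥0∞)) ^ 2 with hm
  have hm_eq : m = ∫⁻ X, ENNReal.ofReal ((θ X) ^ 2) := lintegral_congr fun X => hΘ₀sq X
  have hm_le : m ≤ 1 := by
    rw [hm_eq]; exact lintegral_theta_sq_le_one Φ a hτ hw0 hwc hw1 hF hηpos.le
  have hm1 : 1 ≤ m + b := by
    calc (1 : ℝ≥0∞) ≤ m + ENNReal.ofReal (2 * η) * J := by
          rw [hm_eq]; exact one_le_lintegral_theta_sq_add Φ a hτ hw0 hwc hw1 hF hFdiff hηpos.le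
      _ ≤ m + b := add_le_add le_rfl hηJ
  have hmtop : m ≠ ⊤ := ne_top_of_le_ne_top ENNReal.one_ne_top hm_le
  have hm0 : m ≠ 0 := by
    intro h0
    rw [h0, zero_add] at hm1
    have : (1 : ℝ≥0∞) ≤ 2⁻¹ := hm1.trans hbhalf
    norm_num at this
  -- normalisation constant
  set k : ℝ≥0 := NNReal.sqrt (m.toNNReal)⁻¹ with hk
  have hkm : (k : ℝ≥0∞) ^ 2 * m = 1 := by
    rw [hk, ← ENNReal.coe_pow, NNReal.sq_sqrt, ENNReal.coe_inv (ENNReal.toNNReal_ne_zero.2 ⟨hm0, hmtop⟩),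
      ENNReal.coe_toNNReal hmtop, ENNReal.inv_mul_cancel hm0 hmtop]
  have hk2 : (k : ℝ≥0∞) ^ 2 = m⁻¹ := ENNReal.eq_inv_of_mul_eq_one_left hkm
  have hkC : ((‖((k : ℝ) : ℂ)‖₊ : ℝ≥0∞)) = k := by
    rw [Complex.nnnorm_real]; simp
  -- the trial state
  have hmeasΘ₀ : Measurable fun X => ((‖Θ₀ X‖₊ : ℝ≥0∞)) ^ 2 :=
    (hΘ₀C1.continuous.measurable.nnnorm.coe_nnreal_ennreal).pow_const 2
  let Θ : TrialState N (L₀ + 2 * τ) :=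
    { ψ := fun X => ((k : ℝ) : ℂ) * Θ₀ X
      contDiff := contDiff_const.mul hΘ₀C1
      eq_zero := fun X hX => by
        have hF0 : F X = 0 := F_eq_zero_of_notMem Φ a hF hτ.le hX
        simp only [hΘ₀, hθ, hF0, add_zero, Real.sqrt_sq hηpos.le, sub_self, Complex.ofReal_zero,
          mul_zero]
      symm := fun σ X => by
        have hFs : F (X ∘ σ) = F X := F_comp_perm Φ a hF σ X
        simp only [hΘ₀, hθ, hFs]
      norm_eq := by
        have h1 : ∀ X, ((‖((k : ℝ) : ℂ) * Θ₀ X‖₊ : ℝ≥0∞)) ^ 2 =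
            (k : ℝ≥0∞) ^ 2 * ((‖Θ₀ X‖₊ : ℝ≥0∞)) ^ 2 := fun X => by
          rw [nnnorm_mul, ENNReal.coe_mul, mul_pow, hkC]
        simp_rw [h1]
        rw [lintegral_const_mul _ hmeasΘ₀, hkm] }
  have hΘψ : Θ.ψ = fun X => ((k : ℝ) : ℂ) * Θ₀ X := rfl
  -- rigid derivatives and relative energy of `Θ` in terms of `θ`
  have hRY : ∀ Y : Config N, (∫⁻ X, ((‖fderiv ℝ Θ.ψ X Y‖₊ : ℝ≥0∞)) ^ 2) =
      m⁻¹ * ∫⁻ X, ENNReal.ofReal ((fderiv ℝ θ X Y) ^ 2) := fun Y => by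
    have hmeas : Measurable fun X => ENNReal.ofReal ((fderiv ℝ θ X Y) ^ 2) :=
      ENNReal.measurable_ofReal.comp ((measurable_fderiv_apply_const ℝ θ Y).pow_const 2)
    rw [hΘψ, ← hk2, ← lintegral_const_mul _ hmeas]
    refine lintegral_congr fun X => ?_
    rw [sq_nnnorm_fderiv_const_mul _ hΘ₀diff, hkC, hΘ₀fd]
  have hrelK : ∫⁻ X, relKineticDensity Θ₀ X ≤ ∫⁻ X, relKineticDensity Φ.ψ X := by
    refine lintegral_relKineticDensity_mono fun Y => ?_
    calc ∫⁻ X, ((‖fderiv ℝ Θ₀ X Y‖₊ : ℝ≥0∞)) ^ 2 = ∫⁻ X, ENNReal.ofReal ((fderiv ℝ θ X Y) ^ 2) :=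
          lintegral_congr fun X => hΘ₀fd X Y
      _ ≤ _ := lintegral_sq_fderiv_theta_le Φ a hτ hw0 hwc hw1 hF hFdiff hFderiv hηpos Y
  have hrelE : relEnergy v Θ ≤ m⁻¹ * relEnergy v Φ := by
    have hmeas1 : Measurable fun X => relKineticDensity Θ₀ X := measurable_relKineticDensity Θ₀
    have hmeas2 : Measurable fun X => relKineticDensity Φ.ψ X := measurable_relKineticDensity Φ.ψ
    have hmeas3 : Measurable fun X => relKineticDensity Θ₀ X + interaction v X * ((‖Θ₀ X‖₊ : ℝ≥0∞)) ^ 2 :=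
      hmeas1.add ((measurable_interaction' hv).mul hmeasΘ₀)
    have hsplit : relEnergy v Θ = (k : ℝ≥0∞) ^ 2 *
        ((∫⁻ X, relKineticDensity Θ₀ X) + ∫⁻ X, interaction v X * ((‖Θ₀ X‖₊ : ℝ≥0∞)) ^ 2) := by
      rw [relEnergy, hΘψ, ← lintegral_add_left hmeas1, ← lintegral_const_mul _ hmeas3]
      refine lintegral_congr fun X => ?_
      rw [relKineticDensity_const_mul _ hΘ₀diff, nnnorm_mul, ENNReal.coe_mul, mul_pow, hkC]
      ring
    rw [hsplit, hk2, relEnergy, lintegral_add_left hmeas2]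
    gcongr m⁻¹ * ?_
    refine add_le_add hrelK ?_
    calc ∫⁻ X, interaction v X * ((‖Θ₀ X‖₊ : ℝ≥0∞)) ^ 2
        = ∫⁻ X, interaction v X * ENNReal.ofReal ((Real.sqrt (η ^ 2 + F X) - η) ^ 2) :=
          lintegral_congr fun X => by rw [hΘ₀sq]
      _ ≤ _ := lintegral_interaction_theta_le Φ a hτ hw0 hwc hw1 hF hv hηpos.le
  -- conclusion
  have hs2 : ENNReal.ofReal s / 2 ≤ ENNReal.ofReal s / 2 := le_rfl
  refine ⟨Θ, ?_, fun b' => ?_, ?_⟩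
  · -- relative energy
    rcases eq_or_ne (relEnergy v Φ) ⊤ with htop | htop
    · rw [htop, top_add]; exact le_top
    refine hrelE.trans (inv_mul_le_add_of_le hm1 hbhalf ?_)
    refine ofReal_mul_le_half htop hβpos.le ?_ hβT
    rw [hT]
    have h2 : (0 : ℝ) ≤ Real.pi ^ 2 / (4 * τ ^ 2) := by positivity
    linarith
  · -- rigid derivatives in every direction
    rcases eq_or_ne (R b') ⊤ with htop | htop
    · rw [show (∫⁻ X, (‖fderiv ℝ Φ.ψ X (fun _ : Fin N => EuclideanSpace.single b' (1 : ℝ))‖₊ : ℝ≥0∞)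
          ^ 2) = R b' from rfl, htop, top_add]
      exact le_top
    rw [hRY]
    calc m⁻¹ * ∫⁻ X, ENNReal.ofReal ((fderiv ℝ θ X (fun _ : Fin N => EuclideanSpace.single b' (1 : ℝ)))
          ^ 2) ≤ m⁻¹ * R b' := by
          gcongr m⁻¹ * ?_
          exact lintegral_sq_fderiv_theta_le Φ a hτ hw0 hwc hw1 hF hFdiff hFderiv hηpos _
      _ ≤ R b' + ENNReal.ofReal s := by
          refine inv_mul_le_add_of_le hm1 hbhalf (ofReal_mul_le_half htop hβpos.le ?_ hβT)
          rw [hT]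
          have h1 : (R b').toReal ≤ ∑ b : Fin 3, (R b).toReal :=
            Finset.single_le_sum (fun b _ => ENNReal.toReal_nonneg) (Finset.mem_univ b')
          have h2 : (0 : ℝ) ≤ (relEnergy v Φ).toReal := ENNReal.toReal_nonneg
          have h3 : (0 : ℝ) ≤ Real.pi ^ 2 / (4 * τ ^ 2) := by positivity
          linarith
  · -- the smeared rigid derivative
    rw [hRY]
    have hpi : (0 : ℝ) ≤ Real.pi ^ 2 / (4 * τ ^ 2) := by positivity
    calc m⁻¹ * ∫⁻ X, ENNReal.ofReal ((fderiv ℝ θ X (fun _ : Fin N => EuclideanSpace.single a (1 : ℝ)))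
          ^ 2) ≤ m⁻¹ * ENNReal.ofReal (Real.pi ^ 2 / (4 * τ ^ 2)) := by
          gcongr m⁻¹ * ?_
          exact lintegral_sq_fderiv_theta_rigid_le Φ a hτ hw0 hu0 hwc huc habs hu1 hF hFdiff hFrigid hηpos
      _ ≤ ENNReal.ofReal (Real.pi ^ 2 / (4 * τ ^ 2)) + ENNReal.ofReal s := by
          refine inv_mul_le_add_of_le hm1 hbhalf
            (ofReal_mul_le_half ENNReal.ofReal_ne_top hβpos.le ?_ hβT)
          rw [ENNReal.toReal_ofReal hpi, hT]
          have h2 : (0 : ℝ) ≤ (relEnergy v Φ).toReal := ENNReal.toReal_nonneg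
          linarith
      _ = ENNReal.ofReal (Real.pi ^ 2 / (4 * τ ^ 2) + s) := (ENNReal.ofReal_add hpi hs.le).symm

end Summit.AtomisticToContinuum.BoseEinsteinCondensation.Theorems.RigidMomentumBound

end
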